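import Summits.Ventures.CertifiedArithmetic.LowPrec.DoubleRoundingSlip
import Summits.Ventures.CertifiedArithmetic.LowPrec.RoundToOdd

/-!
# A double rounding slip lands on an EVEN datum of the wide format — odd intermediates never
# slip (THEOREMS D-dr / D-dm, structural half, continued)

HONEST FRAMING: certified error envelopes and provably optimal rounding/accumulation schemes for
low-precision formats under stated cost models; every table by two implementations; no hardware
or vendor claims.

`DoubleRoundingSlip.lean` (Property 2.1 of [MartinDorelMelquiondMuller2013] for format
records): a slip `fl_φ (fl_ψ x) ≠ fl_φ x` forces `|fl_ψ x|` onto the midpoint of two consecutive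
values of `φ`.  The Lean seat's `two_dvd_man_of_toRat_eq_midpoint` (`RoundToOdd.lean`, after
[BoldoMelquiond2008, Thm 3]): for `m_φ + 2 ≤ m_ψ` such a midpoint has an EVEN trailing
significand in `ψ`.  Combining the two:

* `toRat_eq_add_ulp_of_consecutive` — two consecutive values `0 ≤ v < u` of a format (none
  strictly between) are exactly `ulp(v) = 2^(expCode v - 1)` quanta apart;
* `two_dvd_man_roundNE_of_slip` — for `m_φ + 2 ≤ m_ψ`, `bias φ ≤ bias ψ`,
  `maxRat φ ≤ maxRat ψ` and ANY rational `x`: if the double rounding slips at `x` then the datum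
  `fl_ψ x` has an even trailing significand (`man_roundNE_neg`: the significand of `fl (-x)` is
  that of `fl x`);
* `roundNE_roundNE_of_odd_man` — the contrapositive: an intermediate round-to-nearest-even
  result with an ODD trailing significand is never double rounded wrongly — the parity
  rationale of rounding to odd ([BoldoMelquiond2008, §III]; the Lean seat's
  `RoundToOddDouble.lean` proves `fl_φ ∘ RO_ψ = fl_φ`), here as a property of plain
  round-to-nearest-even intermediates;
* `slip_parity_instance_Binary8p5_BFloat16` — the first failing binary8p5 product in bfloat16,
  `9/128 · 31/16 = 279/2048 ↦ 35/256 = 2^-3 · (1 + 12/128)`: trailing significand `12`, even.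
With `m_ψ = m_φ + 1` the midpoints of `φ` are exactly the odd data of `ψ` in the binade, so the
hypothesis `m_φ + 2 ≤ m_ψ` cannot be dropped (e2m3 → binary8p5: `75/64 ↦ 19/16`, significand
`3`).
Implementation A: `code/enum/slip_midpoint_check.py` (SLIP-MIDPOINT.md §2: the parity column).
References: [MartinDorelMelquiondMuller2013] Property 2.1; [BoldoMelquiond2008] §III, Thm 3.
-/

namespace Summit.Ventures.CertifiedArithmetic

open Literature.ComputerArithmetic.FloatingPoint
open Literature.ComputerArithmetic.FloatingPoint.Format
open Literature.ComputerArithmetic.FloatingPoint.MiniFloat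

/-- CONSECUTIVE VALUES ARE ONE ULP APART: if `0 ≤ v < u` are values of `φ` with no value of `φ`
strictly between them, then `u = v + 2^(expCode v - 1) · quantum φ`.
[cite: BoldoMelquiond2017, §3.1.3] -/
theorem toRat_eq_add_ulp_of_consecutive {φ : Format} {v u : MiniFloat φ} (hv0 : 0 ≤ v.toRat)
    (hvu : v.toRat < u.toRat)
    (hgap : ∀ y : MiniFloat φ, y.toRat ≤ v.toRat ∨ u.toRat ≤ y.toRat) :
    u.toRat = v.toRat + 2 ^ (v.expCode - 1) * φ.quantum := by
  refine le_antisymm ?_ (add_ulp_le_of_lt hv0 hvu)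
  obtain ⟨s, hs⟩ := exists_toRat_eq_add_ulp hv0 hvu
  have hq := φ.quantum_pos
  have hvs : v.toRat < s.toRat := by
    have : 0 < 2 ^ (v.expCode - 1) * φ.quantum := by positivity
    rw [hs]; linarith
  rcases hgap s with h | h
  · exact absurd h (not_le.mpr hvs)
  · rwa [hs] at h

/-- SLIPS LAND ON EVEN DATA (positive inputs): for `m_φ + 2 ≤ m_ψ`, `bias φ ≤ bias ψ`,
`maxRat φ ≤ maxRat ψ` and `x > 0` with `fl_φ (fl_ψ x) ≠ fl_φ x`, the trailing significand of
the datum `fl_ψ x` is even. [cite: MartinDorelMelquiondMuller2013, Property 2.1]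
[cite: BoldoMelquiond2008, Thm 3] -/
theorem two_dvd_man_roundNE_of_slip_pos {φ ψ : Format} (hm2 : φ.manBits + 2 ≤ ψ.manBits)
    (hb : φ.bias ≤ ψ.bias) (hmax : φ.maxRat ≤ ψ.maxRat) {x : ℚ} (hx : 0 < x)
    (h : (roundNE φ (roundNE ψ x).toRat).toRat ≠ (roundNE φ x).toRat) :
    2 ∣ (roundNE ψ x).man := by
  obtain ⟨v, u, hv0, hvx, hxu, hgap, hw, -⟩ := slip_midpoint_of_pos (by omega) hb hmax hx h
  have hu := toRat_eq_add_ulp_of_consecutive hv0 (lt_trans hvx hxu) hgap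
  refine two_dvd_man_of_toRat_eq_midpoint hm2 hb hv0 (roundNE ψ x) ?_
  rw [hw, hu]; ring

/-- The trailing significand of `fl (-x)` is that of `fl x` (round-to-nearest-even acts on the
magnitude). [folklore] -/
theorem man_roundNE_neg {φ : Format} (x : ℚ) :
    (roundNE φ (-x)).man = (roundNE φ x).man := by
  show φ.manOf (φ.rneGrid (|-x| / φ.quantum)) = φ.manOf (φ.rneGrid (|x| / φ.quantum))
  rw [abs_neg]

/-- SLIPS LAND ON EVEN DATA (every input): for `m_φ + 2 ≤ m_ψ`, `bias φ ≤ bias ψ`,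
`maxRat φ ≤ maxRat ψ` and any rational `x` with `fl_φ (fl_ψ x) ≠ fl_φ x`, the trailing
significand of `fl_ψ x` is even. [cite: MartinDorelMelquiondMuller2013, Property 2.1]
[cite: BoldoMelquiond2008, Thm 3] -/
theorem two_dvd_man_roundNE_of_slip {φ ψ : Format} (hm2 : φ.manBits + 2 ≤ ψ.manBits)
    (hb : φ.bias ≤ ψ.bias) (hmax : φ.maxRat ≤ ψ.maxRat) {x : ℚ}
    (h : (roundNE φ (roundNE ψ x).toRat).toRat ≠ (roundNE φ x).toRat) :
    2 ∣ (roundNE ψ x).man := by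
  rcases lt_trichotomy 0 x with hpos | hzero | hneg
  · exact two_dvd_man_roundNE_of_slip_pos hm2 hb hmax hpos h
  · exfalso; apply h
    exact toRat_roundNE_roundNE_of_exists ⟨MiniFloat.zero ψ, by rw [toRat_zero]; exact hzero⟩
  · have h' : (roundNE φ (roundNE ψ (-x)).toRat).toRat ≠ (roundNE φ (-x)).toRat := by
      rw [toRat_roundNE_neg, toRat_roundNE_neg, toRat_roundNE_neg]
      exact fun e => h (neg_inj.mp e)
    have := two_dvd_man_roundNE_of_slip_pos hm2 hb hmax (by linarith) h'
    rwa [man_roundNE_neg] at this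

/-- ODD INTERMEDIATES NEVER SLIP: for `m_φ + 2 ≤ m_ψ`, `bias φ ≤ bias ψ`, `maxRat φ ≤ maxRat ψ`
and any rational `x`, if the round-to-nearest-even datum `fl_ψ x` has an odd trailing
significand then `fl_φ (fl_ψ x) = fl_φ x`. [cite: BoldoMelquiond2008, §III]
[cite: MartinDorelMelquiondMuller2013, Property 2.1] -/
theorem roundNE_roundNE_of_odd_man {φ ψ : Format} (hm2 : φ.manBits + 2 ≤ ψ.manBits)
    (hb : φ.bias ≤ ψ.bias) (hmax : φ.maxRat ≤ ψ.maxRat) {x : ℚ}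
    (hodd : ¬ 2 ∣ (roundNE ψ x).man) :
    (roundNE φ (roundNE ψ x).toRat).toRat = (roundNE φ x).toRat := by
  by_contra h
  exact hodd (two_dvd_man_roundNE_of_slip hm2 hb hmax h)

/-- THE INSTANCE binary8p5 → bfloat16 (`m_φ + 2 = 6 ≤ 7`): the first failing product
`9/128 · 31/16 = 279/2048` is rounded by bfloat16 to `35/256 = 2^-3 · (1 + 12/128)`, trailing
significand `12` (even), and the routes deliver `9/64 ≠ 17/128`; whereas for e2m3 → binary8p5
(`m_ψ = m_φ + 1`, outside the hypothesis) the slipped intermediate `19/16` has the ODD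
significand `3`. [cite: BoldoMelquiond2008, Thm 3] -/
theorem slip_parity_instance_Binary8p5_BFloat16 :
    (roundNE BFloat16 (279 / 2048 : ℚ)).man = 12 ∧
    (roundNE Binary8p5 (roundNE BFloat16 (279 / 2048 : ℚ)).toRat).toRat = 9 / 64 ∧
    (roundNE Binary8p5 (279 / 2048 : ℚ)).toRat = 17 / 128 ∧
    (roundNE Binary8p5 (75 / 64 : ℚ)).man = 3 := by
  refine ⟨?_, ?_, ?_, ?_⟩ <;> decide +kernel

end Summit.Ventures.CertifiedArithmetic
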